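import Summits.PneNP.PneNP.Theorems.SymmetryBudgetHamCompilesStubResidueNPCheck
import Literature.Computability.Complexity.CodeFPStrings
import Literature.Computability.Complexity.CodeFPListKit

/-!
# The untyped verifier is polynomial time (line `kotzig-cutspan`, stub `stub_residueNP`)

Crux `Summit.PneNP.PneNP.Theses.SymmetryBudget.HamCompiles` (stmt-PneNP-10637), line
`kotzig-cutspan`, stub `stub_residueNP` (`ResidueLang ∈ NP`). The tests of
`…StubResidueNPCheck.lean` are computed on codes in polynomial time (`CodeFP`, the typed
combinator algebra of `CodeFP.lean` over the tree's `FP`): the string reads, the header, the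
margins, the path-cover tests (`shapeOK`, `coverOK`, `chainsOK`, `labelsOK`, `slotsOK`), the
stars-and-bars code word `sbNum`, the binary digits `bitsLE`, the admissibility / consistency
tests `admB` / `consB`, the parity test `parityOK` (a loop over the `2^g ≤ |s|` cuts), and the
assembly `check_code : CodeFP (pairE strE certE) bitE check` (registered sub-goal
`stub_residueNP_code`; the environment `(s, m, g, d, PA, s₀)`, coded by `envE` with `g` unary, is
computed from the string and the certificate code: `g = ⌊log₂ m⌋` by `CodeFP.natLog2Min`, headed
lists stripped to raw lists).

Reference: S. Arora, B. Barak, *Computational Complexity: A Modern Approach*, CUP 2009, §1.3.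
-/

-- `Summit.PneNP.PneNP.…` duplicates `PneNP` BY DESIGN (single-problem summit, D-0017).
set_option linter.dupNamespace false

noncomputable section

namespace Summit.PneNP.PneNP.Theorems.HamCompilesKC

open Literature.Computability.Complexity
open Computability CodeFP

namespace ResNP

/-! ### Codes of labelled paths and environments -/

/-- The code of a labelled path with a raw vertex list (a notation, not a definition). -/
local notation "itemR" => (pairE (rawE natE) (pairE natE natE) : List ℕ × ℕ × ℕ → List Bool)

/-- Environments `(s, m, g, d, PA, s₀)` of the verifier (a notation). -/
local notation "Env" => (List Bool × ℕ × ℕ × List ℕ × List (List ℕ × ℕ × ℕ) × ℕ)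

/-- The code of environments (`m`, `s₀` binary; `g` unary; raw lists) (a notation). -/
local notation "envE" =>
  (pairE strE (pairE natE (pairE unE (pairE (rawE natE) (pairE (rawE itemR) natE)))) : Env → List Bool)

/-! ### Reading the string; the header and the margins -/

/-- `bit` on codes. -/
theorem bit_code : CodeFP (pairE strE natE) bitE (fun p => bit p.1 p.2) := strGetDNat

/-- `abit` on codes: `((s, m), (u, v))`. -/
theorem abit_code : CodeFP (pairE (pairE strE natE) (pairE natE natE)) bitE
    (fun t => abit t.1.1 t.1.2 t.2.1 t.2.2) :=
  bit_code.comp ((fst _ _).fst'.pair (natAdd.comp ((snd _ _).snd'.pair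
    (natMul.comp ((fst _ _).snd'.pair (snd _ _).fst')))))

/-- `nbit` on codes: `((s, m), (i, a))`. -/
theorem nbit_code : CodeFP (pairE (pairE strE natE) (pairE natE natE)) bitE
    (fun t => nbit t.1.1 t.1.2 t.2.1 t.2.2) :=
  bit_code.comp ((fst _ _).fst'.pair (natAdd.comp ((natMul.comp ((fst _ _).snd'.pair (fst _ _).snd')).pair
    (natAdd.comp ((snd _ _).snd'.pair (natMul.comp ((fst _ _).snd'.pair (snd _ _).fst')))))))

/-- `2^g` on codes (`g` unary). -/
theorem twoPow_code : CodeFP unE natE (fun g => 2 ^ g) := natPow.comp ((const _ 2).pair (CodeFP.id _))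

/-- `ellN` on codes: `(m, g)` with `g` unary. -/
theorem ellN_code : CodeFP (pairE natE unE) natE (fun p => ellN p.1 p.2) := by
  have hm : CodeFP (pairE natE unE) natE (fun p => p.1) := fst _ _
  have hg : CodeFP (pairE natE unE) natE (fun p => p.2) := (natOfUn.comp (snd _ _)).congr fun _ => rfl
  have hG : CodeFP (pairE natE unE) natE (fun p => 2 ^ p.2) := twoPow_code.comp (snd _ _)
  have h3 : CodeFP (pairE natE unE) natE (fun p => 2 ^ (3 * p.2)) :=
    twoPow_code.comp ((unMulConst 3).comp (snd _ _))
  exact (natAdd.comp ((natAdd.comp ((natMul.comp (hm.pair hm)).pair (natMul.comp (hg.pair hm)))).pair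
    (natMul.comp (h3.pair (natMul.comp (hG.pair hG)))))).congr fun _ => rfl

/-- `hdrOK` on codes: `(s, m, g)`. -/
theorem hdrOK_code : CodeFP (pairE strE (pairE natE unE)) bitE (fun p => hdrOK p.1 p.2.1 p.2.2) :=
  ((natLe.comp ((const _ 4).pair (snd _ _).fst')).and
    (natEq.comp ((strNatLength.comp (fst _ _)).pair (ellN_code.comp (snd _ _))))).congr fun _ => rfl

/-- `dOK` on codes: `(g, d)`. -/
theorem dOK_code : CodeFP (pairE unE (rawE natE)) bitE (fun p => dOK p.1 p.2) :=
  ((natEq.comp (((natLength natE).comp (snd _ _)).pair (natOfUn.comp (fst _ _)))).and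
    (natLe.comp ((natSum.comp (snd _ _)).pair (natOfUn.comp ((unMulConst 2).comp (fst _ _)))))).congr
    fun _ => rfl

/-! ### The path-cover tests -/

/-- `itemOK` on codes: `((m, g), q)`. -/
theorem itemOK_code : CodeFP (pairE (pairE natE unE) itemR) bitE (fun t => itemOK t.1.1 t.1.2 t.2) := by
  have hall : CodeFP (pairE (pairE natE unE) (rawE natE)) bitE (fun q => q.2.all fun v => decide (v < q.1.1)) :=
    all (natLt.comp ((snd _ _).pair (fst _ _).fst'))
  have hg : CodeFP (pairE (pairE natE unE) itemR) natE (fun t => t.1.2) :=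
    (natOfUn.comp (fst _ _).snd').congr fun _ => rfl
  exact (((((rawIsEmpty natE).comp (snd _ _).fst').not.and (hall.comp ((fst _ _).pair (snd _ _).fst'))).and
    (natLt.comp ((snd _ _).snd'.fst'.pair hg))).and (natLt.comp ((snd _ _).snd'.snd'.pair hg))).congr
    fun _ => rfl

/-- `shapeOK` on codes: `((m, g), PA)`. -/
theorem shapeOK_code : CodeFP (pairE (pairE natE unE) (rawE itemR)) bitE (fun q => shapeOK q.1.1 q.1.2 q.2) :=
  (all itemOK_code).congr fun _ => rfl

/-- `verts` on codes. -/
theorem verts_code : CodeFP (rawE itemR) (rawE natE) verts :=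
  ((flatten natE).comp (map₀ (fst (rawE natE) (pairE natE natE)))).congr fun _ => rfl

/-- `coverOK` on codes: `((m, g, cap), PA)` with `g`, `cap` unary. -/
theorem coverOK_code : CodeFP (pairE (pairE natE (pairE unE unE)) (rawE itemR)) bitE
    (fun q => coverOK q.1.1 q.1.2.1 q.1.2.2 q.2) := by
  let cE : (ℕ × ℕ × ℕ) × List (List ℕ × ℕ × ℕ) → List Bool :=
    pairE (pairE natE (pairE unE unE)) (rawE itemR)
  have hV : CodeFP cE (rawE natE) (fun q => verts q.2) := verts_code.comp (snd _ _)
  have hm : CodeFP cE natE (fun q => q.1.1) := (fst _ _).fst'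
  have hg : CodeFP cE natE (fun q => q.1.2.1) := (natOfUn.comp (fst _ _).snd'.fst').congr fun _ => rfl
  have h1 : CodeFP cE bitE (fun q => decide (verts q.2).Nodup) := (nodup natE_injective).comp hV
  have h2 : CodeFP cE bitE (fun q => (verts q.2).all fun v => decide (v + q.1.2.1 < q.1.1)) :=
    (all (σ := ℕ × ℕ) (eσ := pairE natE natE) (p := fun t => decide (t.2 + t.1.2 < t.1.1))
      (natLt.comp ((natAdd.comp ((snd _ _).pair (fst _ _).snd')).pair (fst _ _).fst'))).comp
      ((hm.pair hg).pair hV)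
  have hR : CodeFP cE (rawE natE) (fun q => List.range (min (q.1.1 - q.1.2.1) q.1.2.2)) :=
    urange.comp (unOfNatMin.comp ((fst _ _).snd'.snd'.pair (natSub.comp (hm.pair hg))))
  have h3 : CodeFP cE bitE (fun q => (List.range (min (q.1.1 - q.1.2.1) q.1.2.2)).all
      fun v => decide (v ∈ verts q.2)) :=
    (all (σ := List ℕ) (eσ := rawE natE) (p := fun t => decide (t.2 ∈ t.1))
      ((mem natE_injective).comp ((snd _ _).pair (fst _ _)))).comp (hV.pair hR)
  exact ((h1.and h2).and h3).congr fun _ => rfl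

/-- `adjB` on codes: `((s, m), (u, v))`. -/
theorem adjB_code : CodeFP (pairE (pairE strE natE) (pairE natE natE)) bitE
    (fun t => adjB t.1.1 t.1.2 t.2.1 t.2.2) :=
  ((natEq.comp (snd _ _)).not.and (abit_code.or (abit_code.comp ((fst _ _).pair
    ((snd _ _).snd'.pair (snd _ _).fst'))))).congr fun _ => rfl

/-- `chainB` on codes, for a relation with a context. -/
theorem chainB_code {σ : Type} {eσ : σ → List Bool} {R : σ × ℕ × ℕ → Bool}
    (hR : CodeFP (pairE eσ (pairE natE natE)) bitE R) :
    CodeFP (pairE eσ (rawE natE)) bitE (fun q => chainB (fun a b => R (q.1, a, b)) q.2) := by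
  have hZ : CodeFP (pairE eσ (rawE natE)) (rawE bitE)
      (fun q => List.zipWith (fun a b => R (q.1, a, b)) q.2 q.2.tail) :=
    (zipWith hR).comp ((fst _ _).pair ((snd _ _).pair ((rawTail natE).comp (snd _ _))))
  exact ((all (σ := σ × List ℕ) (eσ := pairE eσ (rawE natE)) (p := fun t : (σ × List ℕ) × Bool => t.2)
    (snd _ _)).comp ((CodeFP.id _).pair hZ)).congr fun _ => rfl

/-- `chainsOK` on codes: `((s, m), PA)`. -/
theorem chainsOK_code : CodeFP (pairE (pairE strE natE) (rawE itemR)) bitE (fun q => chainsOK q.1.1 q.1.2 q.2) :=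
  (all ((chainB_code (R := fun t => adjB t.1.1 t.1.2 t.2.1 t.2.2) adjB_code).comp
    ((fst _ _).pair (snd _ _).fst'))).congr fun _ => rfl

/-- `lastD` on codes. -/
theorem lastD_code : CodeFP (rawE natE) natE lastD :=
  ((rawGetD natE (d := 0) rfl).comp ((CodeFP.id _).pair (natSub.comp (((natLength natE)).pair
    (const _ 1))))).congr fun _ => rfl

/-- `labelsOK` on codes: `((s, m), PA)`. -/
theorem labelsOK_code : CodeFP (pairE (pairE strE natE) (rawE itemR)) bitE (fun q => labelsOK q.1.1 q.1.2 q.2) := by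
  have hb : CodeFP (pairE (pairE strE natE) itemR) bitE
      (fun t => nbit t.1.1 t.1.2 t.2.2.1 (t.2.1.headD 0) && nbit t.1.1 t.1.2 t.2.2.2 (lastD t.2.1)) :=
    (nbit_code.comp ((fst _ _).pair ((snd _ _).snd'.fst'.pair ((rawHeadD natE (d := 0) rfl).comp
      (snd _ _).fst')))).and
    (nbit_code.comp ((fst _ _).pair ((snd _ _).snd'.snd'.pair (lastD_code.comp (snd _ _).fst'))))
  exact (all hb).congr fun _ => rfl

/-- `slotsOK` on codes: `(g, d, PA)`. -/
theorem slotsOK_code : CodeFP (pairE unE (pairE (rawE natE) (rawE itemR))) bitE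
    (fun q => slotsOK q.1 q.2.1 q.2.2) := by
  let cE : ℕ × List ℕ × List (List ℕ × ℕ × ℕ) → List Bool :=
    pairE unE (pairE (rawE natE) (rawE itemR))
  have hL1 : CodeFP cE (rawE natE) (fun q => q.2.2.map fun r => r.2.1) := (map₀ (snd _ _).fst').comp (snd _ _).snd'
  have hL2 : CodeFP cE (rawE natE) (fun q => q.2.2.map fun r => r.2.2) := (map₀ (snd _ _).snd').comp (snd _ _).snd'
  have hd : CodeFP cE (rawE natE) (fun q => q.2.1) := (snd _ _).fst'
  -- body on `((L₁, L₂, d), i)`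
  let bE : (List ℕ × List ℕ × List ℕ) × ℕ → List Bool :=
    pairE (pairE (rawE natE) (pairE (rawE natE) (rawE natE))) natE
  have hi : CodeFP bE natE (fun t => t.2) := snd _ _
  have hbody : CodeFP bE bitE
      (fun t => decide (t.1.1.count t.2 + t.1.2.1.count t.2 = t.1.2.2.getD t.2 0)) :=
    natEq.comp ((natAdd.comp ((rawCountNat.comp (hi.pair (fst _ _).fst')).pair
      (rawCountNat.comp (hi.pair (fst _ _).snd'.fst')))).pair
      ((rawGetD natE (d := 0) rfl).comp ((fst _ _).snd'.snd'.pair hi)))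
  exact ((all hbody).comp ((hL1.pair (hL2.pair hd)).pair (urange.comp (fst _ _)))).congr fun _ => rfl

/-! ### The stars-and-bars code word -/

/-- `psum` on codes: `((g, d), i)`. -/
theorem psum_code : CodeFP (pairE (pairE unE (rawE natE)) natE) natE (fun q => psum q.1.1 q.1.2 q.2) := by
  have hR : CodeFP (pairE (pairE unE (rawE natE)) natE) (rawE natE) (fun q => List.range (min (q.2 + 1) q.1.1)) :=
    urange.comp (unOfNatMin.comp ((fst _ _).fst'.pair (natAdd.comp ((snd _ _).pair (const _ 1)))))
  have hM : CodeFP (pairE (rawE natE) (rawE natE)) (rawE natE) (fun p => p.2.map fun t => p.1.getD t 0) :=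
    map (rawGetD natE (d := 0) rfl)
  exact (natSum.comp (hM.comp ((fst _ _).snd'.pair hR))).congr fun _ => rfl

/-- `sbTest` on codes: `((g, d), j)`. -/
theorem sbTest_code : CodeFP (pairE (pairE unE (rawE natE)) natE) bitE (fun q => sbTest q.1.1 q.1.2 q.2) := by
  -- body on `(((g, d), j), i)`
  have hb : CodeFP (pairE (pairE (pairE unE (rawE natE)) natE) natE) bitE
      (fun t => decide (t.1.2 = t.2 + psum t.1.1.1 t.1.1.2 t.2)) :=
    natEq.comp ((fst _ _).snd'.pair (natAdd.comp ((snd _ _).pair (psum_code.comp ((fst _ _).fst'.pair (snd _ _))))))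
  exact ((any hb).comp ((CodeFP.id _).pair (urange.comp (fst _ _).fst'))).congr fun _ => rfl

/-- `sbNum` on codes: `(g, d)`. -/
theorem sbNum_code : CodeFP (pairE unE (rawE natE)) natE (fun p => sbNum p.1 p.2) := by
  have h3 : CodeFP (pairE unE (rawE natE)) unE (fun p => 3 * p.1) := (unMulConst 3).comp (fst _ _)
  -- body on `((g, d), j)`
  have hj : CodeFP (pairE (pairE unE (rawE natE)) natE) unE (fun t => min t.2 (3 * t.1.1)) :=
    unOfNatMin.comp ((h3.comp (fst _ _)).pair (snd _ _))
  have hb : CodeFP (pairE (pairE unE (rawE natE)) natE) natE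
      (fun t => if sbTest t.1.1 t.1.2 t.2 then 2 ^ min t.2 (3 * t.1.1) else 0) :=
    sbTest_code.ite (twoPow_code.comp hj) (const _ 0)
  exact (natSum.comp ((map hb).comp ((CodeFP.id _).pair (urange.comp h3)))).congr fun _ => rfl

/-! ### Cuts as numbers: digits, admissibility, consistency -/

/-- `bitsLE` on codes: `(g, n)`. -/
theorem bitsLE_code : CodeFP (pairE unE natE) (rawE natE) (fun p => bitsLE p.1 p.2) := by
  have hb : CodeFP (pairE (pairE unE natE) natE) natE (fun t => t.1.2 / 2 ^ min t.2 t.1.1 % 2) :=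
    natMod.comp ((natDiv.comp ((fst _ _).snd'.pair (twoPow_code.comp (unOfNatMin.comp
      ((fst _ _).fst'.pair (snd _ _)))))).pair (const _ 2))
  exact ((map hb).comp ((CodeFP.id _).pair (urange.comp (fst _ _)))).congr fun _ => rfl

/-- `anchor` on codes. -/
theorem anchor_code : CodeFP (rawE natE) natE anchor :=
  ((findIdxFP (σ := Unit) (eσ := unitE) (p := fun t => decide (0 < t.2))
    (natLt.comp ((const _ 0).pair (snd _ _)))).comp ((const _ ()).pair (CodeFP.id _))).congr fun _ => rfl

/-- `admB` on codes: `((g, d), n)`. -/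
theorem admB_code : CodeFP (pairE (pairE unE (rawE natE)) natE) bitE (fun q => admB q.1.1 q.1.2 q.2) := by
  let cE : (ℕ × List ℕ) × ℕ → List Bool := pairE (pairE unE (rawE natE)) natE
  have hB : CodeFP cE (rawE natE) (fun q => bitsLE q.1.1 q.2) := bitsLE_code.comp ((fst _ _).fst'.pair (snd _ _))
  have hd : CodeFP cE (rawE natE) (fun q => q.1.2) := (fst _ _).snd'
  have ha : CodeFP cE natE (fun q => anchor q.1.2) := anchor_code.comp hd
  -- body on `((B, d), i)`
  have hb : CodeFP (pairE (pairE (rawE natE) (rawE natE)) natE) bitE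
      (fun t => !decide (t.1.1.getD t.2 0 = 1) || decide (0 < t.1.2.getD t.2 0)) :=
    (natEq.comp (((rawGetD natE (d := 0) rfl).comp ((fst _ _).fst'.pair (snd _ _))).pair (const _ 1))).not.or
      (natLt.comp ((const _ 0).pair ((rawGetD natE (d := 0) rfl).comp ((fst _ _).snd'.pair (snd _ _)))))
  have h1 := (all hb).comp ((hB.pair hd).pair (urange.comp (fst _ _).fst') : CodeFP cE _ _)
  have h2 : CodeFP cE bitE (fun q => decide (anchor q.1.2 < q.1.1)) :=
    natLt.comp (ha.pair ((natOfUn.comp (fst _ _).fst').congr fun _ => rfl))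
  have h3 : CodeFP cE bitE (fun q => decide ((bitsLE q.1.1 q.2).getD (anchor q.1.2) 0 = 1)) :=
    natEq.comp (((rawGetD natE (d := 0) rfl).comp (hB.pair ha)).pair (const _ 1))
  exact (h1.and (h2.and h3)).congr fun _ => rfl

/-- `consB` on codes: `((g, PA), n)`. -/
theorem consB_code : CodeFP (pairE (pairE unE (rawE itemR)) natE) bitE (fun q => consB q.1.1 q.1.2 q.2) := by
  have hB : CodeFP (pairE (pairE unE (rawE itemR)) natE) (rawE natE) (fun q => bitsLE q.1.1 q.2) :=
    bitsLE_code.comp ((fst _ _).fst'.pair (snd _ _))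
  -- body on `(B, q)`
  have hget : ∀ {f : List ℕ × (List ℕ × ℕ × ℕ) → ℕ}, CodeFP (pairE (rawE natE) itemR) natE f →
      CodeFP (pairE (rawE natE) itemR) bitE (fun t => decide (t.1.getD (f t) 0 = 1)) := fun hf =>
    natEq.comp (((rawGetD natE (d := 0) rfl).comp ((fst _ _).pair hf)).pair (const _ 1))
  have hb : CodeFP (pairE (rawE natE) itemR) bitE
      (fun t => decide (t.1.getD t.2.2.1 0 = 1) == decide (t.1.getD t.2.2.2 0 = 1)) :=
    (beq bitE_injective).comp ((hget (snd _ _).snd'.fst').pair (hget (snd _ _).snd'.snd'))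
  exact ((all hb).comp (hB.pair (fst _ _).snd')).congr fun _ => rfl

/-! ### The parity test and the assembly -/

section EnvSec

/-- Projection `s`. -/
theorem envS : CodeFP envE strE (fun E => E.1) := fst _ _
/-- Projection `m`. -/
theorem envM : CodeFP envE natE (fun E => E.2.1) := (snd _ _).fst'
/-- Projection `g` (unary). -/
theorem envG : CodeFP envE unE (fun E => E.2.2.1) := (snd _ _).snd'.fst'
/-- Projection `g` (binary). -/
theorem envGN : CodeFP envE natE (fun E => E.2.2.1) := (natOfUn.comp envG).congr fun _ => rfl
/-- Projection `d`. -/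
theorem envD : CodeFP envE (rawE natE) (fun E => E.2.2.2.1) := (snd _ _).snd'.snd'.fst'
/-- Projection `PA`. -/
theorem envP : CodeFP envE (rawE itemR) (fun E => E.2.2.2.2.1) := (snd _ _).snd'.snd'.snd'.fst'
/-- Projection `s₀`. -/
theorem env0 : CodeFP envE natE (fun E => E.2.2.2.2.2) := (snd _ _).snd'.snd'.snd'.snd'

/-- `goodCut` on codes: `(E, n)`. -/
theorem goodCut_code : CodeFP (pairE envE natE) bitE
    (fun q => goodCut q.1.1 q.1.2.1 q.1.2.2.1 q.1.2.2.2.1 q.1.2.2.2.2.1 q.1.2.2.2.2.2 q.2) := by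
  let cE : Env × ℕ → List Bool := pairE envE natE
  have hG : CodeFP cE natE (fun q => 2 ^ q.1.2.2.1) := twoPow_code.comp (envG.comp (fst _ _))
  have hc : CodeFP cE natE (fun q => sbNum q.1.2.2.1 q.1.2.2.2.1) := sbNum_code.comp ((envG.pair envD).comp (fst _ _))
  have hpos : CodeFP cE natE (fun q => (q.1.2.1 * q.1.2.1 + q.1.2.2.1 * q.1.2.1) +
      ((q.2 + 2 ^ q.1.2.2.1 * q.1.2.2.2.2.2) + (2 ^ q.1.2.2.1 * 2 ^ q.1.2.2.1) * sbNum q.1.2.2.1 q.1.2.2.2.1)) :=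
    natAdd.comp ((natAdd.comp ((natMul.comp ((envM.pair envM).comp (fst _ _))).pair
      (natMul.comp ((envGN.pair envM).comp (fst _ _))))).pair
      (natAdd.comp ((natAdd.comp ((snd _ _).pair (natMul.comp (hG.pair (env0.comp (fst _ _)))))).pair
        (natMul.comp ((natMul.comp (hG.pair hG)).pair hc)))))
  have hf : CodeFP cE bitE (fun q => fbit q.1.1 q.1.2.1 q.1.2.2.1 (sbNum q.1.2.2.1 q.1.2.2.2.1) q.1.2.2.2.2.2 q.2) :=
    (bit_code.comp ((envS.comp (fst _ _)).pair hpos)).congr fun _ => rfl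
  have ha : CodeFP cE bitE (fun q => admB q.1.2.2.1 q.1.2.2.2.1 q.2) :=
    admB_code.comp (((envG.pair envD).comp (fst _ _)).pair (snd _ _))
  have hco : CodeFP cE bitE (fun q => consB q.1.2.2.1 q.1.2.2.2.2.1 q.2) :=
    consB_code.comp (((envG.pair envP).comp (fst _ _)).pair (snd _ _))
  exact (hf.and (ha.and hco)).congr fun _ => rfl

/-- `parityOK` on codes (cap `|s|`). -/
theorem parityOK_code : CodeFP envE bitE
    (fun E => parityOK E.1 E.2.1 E.2.2.1 E.1.length E.2.2.2.1 E.2.2.2.2.1 E.2.2.2.2.2) := by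
  have hR : CodeFP envE (rawE natE) (fun E => List.range (min (2 ^ E.2.2.1) E.1.length)) :=
    urange.comp (unOfNatMin.comp ((strLength.comp envS).pair (twoPow_code.comp envG)))
  have hF := (filter goodCut_code).comp ((CodeFP.id _).pair hR)
  exact (natEq.comp ((natMod.comp (((natLength natE).comp hF).pair (const _ 2))).pair (const _ 1))).congr
    fun _ => rfl

/-- **`check₁` on codes.** -/
theorem check₁_code : CodeFP envE bitE
    (fun E => check₁ E.1 E.2.1 E.2.2.1 E.2.2.2.1 E.2.2.2.2.1 E.2.2.2.2.2) := by
  have h1 := hdrOK_code.comp (envS.pair (envM.pair envG))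
  have h2 := dOK_code.comp (envG.pair envD)
  have h3 := shapeOK_code.comp ((envM.pair envG).pair envP)
  have h4 := coverOK_code.comp ((envM.pair (envG.pair (strLength.comp envS))).pair envP)
  have h5 := chainsOK_code.comp ((envS.pair envM).pair envP)
  have h6 := labelsOK_code.comp ((envS.pair envM).pair envP)
  have h7 := slotsOK_code.comp (envG.pair (envD.pair envP))
  have h8 : CodeFP envE bitE (fun E => decide (E.2.2.2.2.2 < 2 ^ E.2.2.1)) :=
    natLt.comp (env0.pair (twoPow_code.comp envG))
  exact ((((((((h1.and h2).and h3).and h4).and h5).and h6).and h7).and h8).and parityOK_code).congr fun _ => rfl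

end EnvSec

/-- **The environment of a string and a certificate code** (`g = ⌊log₂ m⌋` capped by `|s|`,
headed lists stripped). -/
theorem envOf_code : CodeFP (pairE strE certE) envE
    (fun p => (p.1, p.2.1, min p.1.length (Nat.log 2 p.2.1), p.2.2.1, p.2.2.2.1, p.2.2.2.2)) := by
  let cE : List Bool × Cert → List Bool := pairE strE certE
  have hs : CodeFP cE strE (fun p => p.1) := fst _ _
  have hm : CodeFP cE natE (fun p => p.2.1) := (snd _ _).fst'
  have hg : CodeFP cE unE (fun p => min p.1.length (Nat.log 2 p.2.1)) := by
    refine ((unOfNatMin.comp ((strLength.comp hs).pair (natLog2Min.comp (hm.pair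
      (replicateUnit.comp (strLength.comp hs)))))).congr fun p => ?_)
    rw [List.length_replicate]
    exact min_eq_left (min_le_left _ _)
  have hd : CodeFP cE (rawE natE) (fun p => p.2.2.1) := ((rawOfList natE).comp (snd _ _).snd'.fst').congr fun _ => rfl
  have hi : CodeFP itemE itemR (fun q => (q.1, q.2)) :=
    (((rawOfList natE).comp (fst _ _)).pair (snd _ _)).congr fun _ => rfl
  have hP : CodeFP cE (rawE itemR) (fun p => p.2.2.2.1) :=
    (((map₀ hi).comp ((rawOfList itemE).comp (snd _ _).snd'.snd'.fst')).congr fun p => by simp)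
  have h0 : CodeFP cE natE (fun p => p.2.2.2.2) := (snd _ _).snd'.snd'.snd'
  exact hs.pair (hm.pair (hg.pair (hd.pair (hP.pair h0))))

/-- **The verifier is computed on codes in polynomial time.** -/
theorem check_code : CodeFP (pairE strE certE) bitE check :=
  ((natLe.comp ((snd _ _).fst'.pair (strNatLength.comp (fst _ _)))).and (check₁_code.comp envOf_code)).congr
    fun _ => rfl

end ResNP

/-- Registered sub-goal of `stub_residueNP` served by this file: the verifier is computed on codes in
polynomial time. -/
theorem stub_residueNP_code : CodeFP (CodeFP.pairE CodeFP.strE ResNP.certE) CodeFP.bitE ResNP.check :=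
  ResNP.check_code


end Summit.PneNP.PneNP.Theorems.HamCompilesKC
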